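import Summits.RiemannHypothesis.RiemannHypothesis.Theorems.PfPersistenceEigenspaceTolerance
import Summits.RiemannHypothesis.RiemannHypothesis.Theorems.PfPersistenceCentralMassFloor
import HarnessLib

/-!
# PF persistence — the ONE-SIGNED face's binder made QUALITATIVE: simple bottom + nowhere-vanishing bottom
profile (pub-rhpf, barrier-prover gen 4; rider to the binder-free eigenvector wall)

**HONEST FRAMING. This is a long-odds MECHANISM SEARCH; no RH claims.** RH-free finite-dimensional linear
algebra and one compactness step; every statement PROVED; no DATA. Nothing here bears on the truth of RH.

The one-signed wall of `Theorems/PfPersistenceEigenvectorTolerance.lean`,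
`not_separates_of_oneSignedAt_subset`, carries the NUMERICAL binders `HasBottomGap (zetaDatum win) u₀ γ` and
`OneSignedMargin (2·a) m₀ u₀ ∧ 0 < m₀` on `ζ`'s bottom vector at the window.  This file restates them WITHOUT
NUMBERS: by `hasBottomGap_iff_simple` (`Theorems/PfPersistenceEigenspaceTolerance.lean`) the gap binder is
exactly "`u₀` is a bottom vector and the bottom is simple", and by compactness of the closed window a bottom
profile that vanishes NOWHERE on `[-a, a]` (keeps one STRICT sign) has a positive margin
(`exists_margin_of_strictOneSigned`; the converse `strictOneSigned_of_oneSignedMargin` is immediate).  Hence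
`not_separates_of_oneSignedAt_subset_of_simple`: at a window where `ζ`'s bottom is SIMPLE with a bottom profile
vanishing nowhere on the closed window, the one-signed class separates `ζ` from the negatives of no
`D ⊇ arithDialSpace` — the same wall, binder of record now "simple + nodeless on the closed window" (two
qualitative hypotheses on `ζ` at ONE window, never asserted here).  "Unconditional" keeps the cell's meaning:
the wall is dichotomy-carried (`not_separates_of_robustWithin_arith`) and decides nothing about `ζ`.
-/

set_option linter.dupNamespace false  -- the mandated namespace repeats `RiemannHypothesis`

noncomputable section

open Real Finset Matrix Set

namespace Summit.RiemannHypothesis.RiemannHypothesis.Theorems.PfPersistence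

/-- **PROVED — a margin gives a strict sign.** [folklore] -/
theorem strictOneSigned_of_oneSignedMargin {L m : ℝ} {N : ℕ} {u : Fin (N + 1) → ℝ} (hm : 0 < m)
    (hmar : OneSignedMargin L m u) :
    (∀ x ∈ Set.Icc (-(L / 2)) (L / 2), 0 < profile L u x) ∨
      (∀ x ∈ Set.Icc (-(L / 2)) (L / 2), profile L u x < 0) := by
  rcases hmar with h | h
  · exact Or.inl fun x hx => lt_of_lt_of_le hm (h x hx)
  · exact Or.inr fun x hx => by linarith [h x hx]

/-- **PROVED — A STRICT SIGN ON THE CLOSED WINDOW GIVES A MARGIN** (compactness of `[-L/2, L/2]`, continuity of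
the profile): if the profile of `u` is `> 0` at every point of the closed window (or `< 0` at every point), then
`OneSignedMargin L m₀ u` for some `m₀ > 0`. [folklore] -/
theorem exists_margin_of_strictOneSigned {L : ℝ} (hL : 0 < L) {N : ℕ} {u : Fin (N + 1) → ℝ}
    (hstrict : (∀ x ∈ Set.Icc (-(L / 2)) (L / 2), 0 < profile L u x) ∨
      (∀ x ∈ Set.Icc (-(L / 2)) (L / 2), profile L u x < 0)) :
    ∃ m₀ : ℝ, 0 < m₀ ∧ OneSignedMargin L m₀ u := by
  have hK : IsCompact (Set.Icc (-(L / 2)) (L / 2)) := isCompact_Icc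
  have hne : (Set.Icc (-(L / 2)) (L / 2)).Nonempty := ⟨0, by constructor <;> linarith⟩
  have hcont : Continuous fun x => profile L u x := CentralMassFloor.continuous_profile L u
  rcases hstrict with h | h
  · obtain ⟨x₀, hx₀, hmin⟩ := hK.exists_isMinOn hne hcont.continuousOn
    exact ⟨profile L u x₀, h x₀ hx₀, Or.inl fun x hx => hmin hx⟩
  · obtain ⟨x₀, hx₀, hmax⟩ := hK.exists_isMaxOn hne hcont.continuousOn
    refine ⟨-profile L u x₀, by linarith [h x₀ hx₀], Or.inr fun x hx => ?_⟩
    have := hmax hx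
    simp only [neg_neg]
    exact this

/-- **PROVED — ONE-SIGNEDNESS ROBUST AT `ζ` UNDER THE QUALITATIVE BINDER**: if `ζ`'s bottom at the window is
SIMPLE (bottom vector `u₀`, every bottom vector a real multiple of it) and the bottom profile keeps one STRICT
sign on the closed window `[-a, a]`, then `oneSignedAt win` is robust at `ζ` within the dial space.  (The
numerical binders `γ`, `m₀` of `robustWithin_dialSpace_oneSignedAt` are produced inside the proof by
`hasBottomGap_of_simple` and `exists_margin_of_strictOneSigned`; both hypotheses are on `ζ` at ONE window and
are never asserted.) [folklore] -/
theorem robustWithin_dialSpace_oneSignedAt_of_simple (win : Window) {u₀ : Fin (win.N + 1) → ℝ}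
    (hu₀ : IsBottomVector (zetaDatum win) u₀)
    (hsimple : ∀ u, IsBottomVector (zetaDatum win) u → ∃ c : ℝ, u = c • u₀)
    (hstrict : (∀ x ∈ Set.Icc (-win.a) win.a, 0 < profile (2 * win.a) u₀ x) ∨
      (∀ x ∈ Set.Icc (-win.a) win.a, profile (2 * win.a) u₀ x < 0)) :
    RobustWithin dialSpace (oneSignedAt win) zetaDatum := by
  have hL : 0 < 2 * win.a := by linarith [win.ha]
  have e : 2 * win.a / 2 = win.a := by ring
  obtain ⟨γ, hgap⟩ := hasBottomGap_of_simple (zetaDatum_isSymm win) hu₀ hsimple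
  obtain ⟨m₀, hm₀, hmar⟩ := exists_margin_of_strictOneSigned (u := u₀) hL (by rw [e]; exact hstrict)
  exact robustWithin_dialSpace_oneSignedAt win hgap hmar hm₀

/-- **PROVED — THE ONE-SIGNED WALL WITH A QUALITATIVE BINDER (relative W2 form, unconditional in the cell's
dichotomy-carried sense).**  At a window where `ζ`'s bottom is simple and its bottom profile vanishes nowhere on
the closed window, the one-signed class `oneSignedAt win ∩ arithDialSpace` separates `ζ` from the negatives of
no `D ⊇ arithDialSpace`.  Same conclusion as `not_separates_of_oneSignedAt_subset`; the binder of record is now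
"simple bottom + nodeless bottom profile on `[-a, a]`" — no gap size, no margin size. [folklore] -/
theorem not_separates_of_oneSignedAt_subset_of_simple (win : Window) {u₀ : Fin (win.N + 1) → ℝ}
    (hu₀ : IsBottomVector (zetaDatum win) u₀)
    (hsimple : ∀ u, IsBottomVector (zetaDatum win) u → ∃ c : ℝ, u = c • u₀)
    (hstrict : (∀ x ∈ Set.Icc (-win.a) win.a, 0 < profile (2 * win.a) u₀ x) ∨
      (∀ x ∈ Set.Icc (-win.a) win.a, profile (2 * win.a) u₀ x < 0))
    {S D : Set Datum} (hS : oneSignedAt win ∩ arithDialSpace ⊆ S) (hD : arithDialSpace ⊆ D) :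
    ¬ Separates S D zetaDatum :=
  not_separates_of_robustWithin_arith hD
    (((robustWithin_dialSpace_oneSignedAt_of_simple win hu₀ hsimple hstrict).anti
      arithDialSpace_subset_dialSpace).mono hS)

/-- **PROVED — the two binders of record are EQUIVALENT** (symmetric window matrix, `0 < L`): "gap `γ` at `u₀` and
margin `m₀ > 0`" for some `γ, m₀` iff "`u₀` is a bottom vector, the bottom is simple, and the profile of `u₀`
keeps one strict sign on the closed window". [folklore] -/
theorem exists_gap_margin_iff_simple_strict {N : ℕ} {M : Matrix (Fin (N + 1)) (Fin (N + 1)) ℝ} (hM : M.IsSymm)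
    {L : ℝ} (hL : 0 < L) (u₀ : Fin (N + 1) → ℝ) :
    (∃ γ m₀ : ℝ, HasBottomGap M u₀ γ ∧ 0 < m₀ ∧ OneSignedMargin L m₀ u₀) ↔
      (IsBottomVector M u₀ ∧ (∀ u, IsBottomVector M u → ∃ c : ℝ, u = c • u₀) ∧
        ((∀ x ∈ Set.Icc (-(L / 2)) (L / 2), 0 < profile L u₀ x) ∨
          (∀ x ∈ Set.Icc (-(L / 2)) (L / 2), profile L u₀ x < 0))) := by
  constructor
  · rintro ⟨γ, m₀, hgap, hm₀, hmar⟩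
    obtain ⟨hu₀, hsimple⟩ := (hasBottomGap_iff_simple hM).1 ⟨γ, hgap⟩
    exact ⟨hu₀, hsimple, strictOneSigned_of_oneSignedMargin hm₀ hmar⟩
  · rintro ⟨hu₀, hsimple, hstrict⟩
    obtain ⟨γ, hgap⟩ := hasBottomGap_of_simple hM hu₀ hsimple
    obtain ⟨m₀, hm₀, hmar⟩ := exists_margin_of_strictOneSigned hL hstrict
    exact ⟨γ, m₀, hgap, hm₀, hmar⟩

end Summit.RiemannHypothesis.RiemannHypothesis.Theorems.PfPersistence

end
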